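import Mathlib
import HarnessLib
import Literature.Analysis.Calculus.IteratedFDerivParametricIntegral
import Summits.HubbardSuperconductivity.HubbardSuperconductivity.Theorems.KLProgrammeC4aInvariantDefs

/-!
# Route `KLProgramme` — crux C4a (inductive tangential bound), sub-lemma (L2)-core: the jets of an angular loop integral read on the
# curve are the INTEGRATED CO-MOVING JETS of its integrand

Cell `gate-hubbard-kl`, lane hubbard-kl-c4a-1 (memo HOME/hubbard-kl-c4a-1/C4A-PLAN.md §2c, §6 (L2)).  Helper for the ENGINE item
stmt-HubbardSuperconductivity-20236 (sixth stub: angular jets of the scale-`n` local-part increment).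

THE STATEMENT.  Let `Ψ : ℝ × ℝ → F` be jointly smooth and `T`-periodic in its second (loop) variable, and
`I(θ) := ∫_{0}^{T} Ψ(θ, ϑ) dϑ` (the external angle `θ`, the loop angle `ϑ`; in the application `Ψ(θ, ϑ) = J(ρ, ϑ)·g_n(ρ)·V(Φ(0, θ), Φ(ρ, ϑ))`
at fixed level `ρ` and frequency, `Φ = levelPoint μ K` the co-moving chart of `…C4aInvariantDefs`).  By periodicity
`I(θ) = ∫_{0}^{T} Ψ(θ, ϑ + θ) dϑ` (`intervalIntegral_periodic_shift`): the loop variable may be SHIFTED ALONG with the external one, and then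
  `‖I⁽ⁿ⁾(θ)‖ ≤ ∫_{0}^{T} g(ϑ) dϑ` whenever `‖∂_θⁿ Ψ(θ, ϑ + θ)‖ ≤ g(ϑ)`   (`norm_iteratedDeriv_periodic_integral_le`),
i.e. the `n`-th jet of the loop integral is bounded by the `L¹(dϑ)`-norm of the `n`-th CO-MOVING jet of the integrand (differentiation
under the integral sign: the tree's `Literature.Analysis.Calculus.norm_iteratedFDeriv_integral_le`, measurability by
`continuous_iteratedFDeriv_comp_affine_param` — `θ ↦ Ψ(θ, ϑ + θ)` is `Ψ` along the affine map `θ ↦ (θ, θ) + (0, ϑ)`).  The point of the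
shift: in the co-moving form the slice propagator factor is `θ`-INDEPENDENT (`profile_coMoving_const`) and the vertex factor is
differentiated along the co-moving field only (`CoMovingJets`), so `g` carries no inverse power of the scale away from the umklapp corners;
the `L¹(dϑ)` (not sup) form is what keeps the constants `n`-free for the logarithmically concentrated Cooper region (memo §2c).

* §1 `intervalIntegral_periodic_shift`; §2 `norm_iteratedDeriv_periodic_integral_le` (general Banach `F`, any period `T > 0`);
  §3 `norm_iteratedDeriv_coMoving_integral_le`: the same read through `coMoving μ K V 0 ρ ϑ` for an integrand
  `Ψ(θ, ϑ) = w(ϑ) • V(levelPoint μ K 0 θ, levelPoint μ K ρ ϑ)`.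

Pure analysis; nothing is asserted about the Hubbard model (the `q₀`-sum, the `ρ`-integral against the slice profile and the
lattice-sum ↔ integral aliasing are the consumer's outer layers).  References: FST II CPAM 51 (1998) 1133 Thm 3.5 (the change of variables);
Hörmander, ALPDO I Thm 1.1.9 (differentiation under the integral) [folklore]; BGM 2006 §2.4 [cite: BenfattoGiulianiMastropietro2006].
-/

noncomputable section

namespace Summit.HubbardSuperconductivity.HubbardSuperconductivity.Theorems.C4a

set_option linter.dupNamespace false -- summit = problem name (single-conjunct summit), D-0017

open Real Set MeasureTheory intervalIntegral
open scoped ContDiff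
open Literature.Analysis.Calculus
open Literature.MathematicalPhysics.QuantumLattice

variable {F : Type*} [NormedAddCommGroup F] [NormedSpace ℝ F]

/-! ## §1 Shifting the loop variable along with the external one -/

/-- **Periodic shift of the loop variable**: for `f` `T`-periodic, `∫_{0}^{T} f(ϑ + θ) dϑ = ∫_{0}^{T} f(ϑ) dϑ`. -/
theorem intervalIntegral_periodic_shift {f : ℝ → F} {T : ℝ} (hf : Function.Periodic f T) (θ : ℝ) :
    ∫ ϑ in (0 : ℝ)..T, f (ϑ + θ) = ∫ ϑ in (0 : ℝ)..T, f ϑ := by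
  rw [intervalIntegral.integral_comp_add_right f θ, zero_add, add_comm T θ]
  have h := hf.intervalIntegral_add_eq θ 0
  rw [zero_add] at h
  exact h

/-- The loop integral in CO-MOVING form: `∫_{0}^{T} Ψ(θ, ϑ) dϑ = ∫_{0}^{T} Ψ(θ, ϑ + θ) dϑ` for every `θ`, when `Ψ(θ, ·)` is `T`-periodic. -/
theorem intervalIntegral_eq_coMoving {Ψ : ℝ × ℝ → F} {T : ℝ} (hper : ∀ θ, Function.Periodic (fun ϑ => Ψ (θ, ϑ)) T)
    (θ : ℝ) : ∫ ϑ in (0 : ℝ)..T, Ψ (θ, ϑ) = ∫ ϑ in (0 : ℝ)..T, Ψ (θ, ϑ + θ) :=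
  (intervalIntegral_periodic_shift (hper θ) θ).symm

/-! ## §2 Jets of the loop integral ≤ integrated co-moving jets -/

section Jets

variable [CompleteSpace F]

omit [NormedAddCommGroup F] [NormedSpace ℝ F] [CompleteSpace F] in
/-- The co-moving integrand `θ ↦ Ψ(θ, ϑ + θ)` is `Ψ` along the affine map `θ ↦ (θ, θ) + (0, ϑ)`. -/
theorem coMoving_integrand_eq_affine (Ψ : ℝ × ℝ → F) (ϑ : ℝ) :
    (fun θ : ℝ => Ψ (θ, ϑ + θ)) =
      fun θ : ℝ => Ψ (((ContinuousLinearMap.id ℝ ℝ).prod (ContinuousLinearMap.id ℝ ℝ)) θ + ((0 : ℝ), ϑ)) := by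
  funext θ
  simp [add_comm]

/-- **Jets of a periodic loop integral are bounded by the integrated co-moving jets.**  `Ψ` jointly `C^∞`, `T`-periodic in the loop
variable (`T > 0`), with co-moving jets dominated at every order by some integrable function (qualitative hypothesis for differentiating
under the integral); then for the order `n` and any integrable `g` with `‖∂_θⁿ Ψ(θ, ϑ + θ)‖ ≤ g(ϑ)` for all `ϑ`:
`‖∂_θⁿ ∫_{0}^{T} Ψ(θ, ϑ) dϑ‖ ≤ ∫_{0}^{T} g(ϑ) dϑ`. -/
theorem norm_iteratedDeriv_periodic_integral_le {Ψ : ℝ × ℝ → F} (hΨ : ContDiff ℝ ∞ Ψ) {T : ℝ} (hT : 0 < T)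
    (hper : ∀ θ, Function.Periodic (fun ϑ => Ψ (θ, ϑ)) T)
    (hdom : ∀ m : ℕ, ∃ g : ℝ → ℝ, IntegrableOn g (Ioc 0 T) ∧
      ∀ ϑ θ, ‖iteratedDeriv m (fun θ : ℝ => Ψ (θ, ϑ + θ)) θ‖ ≤ g ϑ)
    {n : ℕ} {θ : ℝ} {g : ℝ → ℝ} (hg : IntegrableOn g (Ioc 0 T))
    (hb : ∀ ϑ, ‖iteratedDeriv n (fun θ : ℝ => Ψ (θ, ϑ + θ)) θ‖ ≤ g ϑ) :
    ‖iteratedDeriv n (fun θ : ℝ => ∫ ϑ in (0 : ℝ)..T, Ψ (θ, ϑ)) θ‖ ≤ ∫ ϑ in (0 : ℝ)..T, g ϑ := by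
  -- the co-moving form of the integral, as a Bochner integral over `Ioc 0 T`
  set μ : Measure ℝ := volume.restrict (Ioc 0 T) with hμ
  set H : ℝ → ℝ → F := fun ϑ θ => Ψ (θ, ϑ + θ) with hH
  have hfun : (fun θ : ℝ => ∫ ϑ in (0 : ℝ)..T, Ψ (θ, ϑ)) = fun θ => ∫ ϑ, H ϑ θ ∂μ := by
    funext θ'
    rw [intervalIntegral_eq_coMoving hper θ', intervalIntegral.integral_of_le hT.le]
  -- hypotheses of the differentiation-under-the-integral theorem
  set L : ℝ →L[ℝ] ℝ × ℝ := (ContinuousLinearMap.id ℝ ℝ).prod (ContinuousLinearMap.id ℝ ℝ) with hL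
  have hHaff : ∀ ϑ, H ϑ = fun θ : ℝ => Ψ (L θ + ((0 : ℝ), ϑ)) := fun ϑ => coMoving_integrand_eq_affine Ψ ϑ
  have h1 : ∀ ϑ, ContDiff ℝ ∞ (H ϑ) := by
    intro ϑ
    rw [hHaff ϑ]
    exact hΨ.comp ((L.contDiff).add contDiff_const)
  have h2 : ∀ (m : ℕ) (p : ℝ), AEStronglyMeasurable (fun ϑ => iteratedFDeriv ℝ m (H ϑ) p) μ := by
    intro m p
    have hc : Continuous fun ϑ : ℝ => ((0 : ℝ), ϑ) := continuous_const.prodMk continuous_id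
    have hcont := continuous_iteratedFDeriv_comp_affine_param (C := ℝ) hΨ L hc m p
    have heq : (fun ϑ => iteratedFDeriv ℝ m (H ϑ) p) = fun ϑ : ℝ => iteratedFDeriv ℝ m (fun θ : ℝ => Ψ (L θ + ((0 : ℝ), ϑ))) p := by
      funext ϑ; rw [hHaff ϑ]
    rw [heq]
    exact hcont.aestronglyMeasurable
  have h3 : ∀ m : ℕ, ∃ g : ℝ → ℝ, Integrable g μ ∧ ∀ ϑ p, ‖iteratedFDeriv ℝ m (H ϑ) p‖ ≤ g ϑ := by
    intro m
    obtain ⟨g', hg', hb'⟩ := hdom m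
    exact ⟨g', hg', fun ϑ p => by rw [norm_iteratedFDeriv_eq_norm_iteratedDeriv]; exact hb' ϑ p⟩
  have hb2 : ∀ ϑ, ‖iteratedFDeriv ℝ n (H ϑ) θ‖ ≤ g ϑ := fun ϑ => by
    rw [norm_iteratedFDeriv_eq_norm_iteratedDeriv]; exact hb ϑ
  have hmain := norm_iteratedFDeriv_integral_le (μ := μ) h1 h2 h3 (n := n) (p := θ) hg hb2
  rw [hfun, ← norm_iteratedFDeriv_eq_norm_iteratedDeriv, intervalIntegral.integral_of_le hT.le]
  exact hmain

omit [CompleteSpace F] in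
/-- **Doubly periodic smooth integrands satisfy the domination hypothesis automatically**: if `Ψ` is `C^∞` and `T`-periodic in
BOTH variables (the loop angle and the external angle), every co-moving jet `(ϑ, θ) ↦ ∂_θᵐ Ψ(θ, ϑ + θ)` is continuous and doubly
`T`-periodic, hence bounded — a CONSTANT dominator at every order (the qualitative hypothesis `hdom` of
`norm_iteratedDeriv_periodic_integral_le`; the quantitative `g` of order `n` is supplied separately). -/
theorem exists_const_dom_of_periodic {Ψ : ℝ × ℝ → F} (hΨ : ContDiff ℝ ∞ Ψ) {T : ℝ} (hT : 0 < T)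
    (hper : ∀ θ, Function.Periodic (fun ϑ => Ψ (θ, ϑ)) T) (hperθ : ∀ ϑ, Function.Periodic (fun θ => Ψ (θ, ϑ)) T) (m : ℕ) :
    ∃ g : ℝ → ℝ, IntegrableOn g (Ioc 0 T) ∧ ∀ ϑ θ, ‖iteratedDeriv m (fun θ : ℝ => Ψ (θ, ϑ + θ)) θ‖ ≤ g ϑ := by
  set L : ℝ →L[ℝ] ℝ × ℝ := (ContinuousLinearMap.id ℝ ℝ).prod (ContinuousLinearMap.id ℝ ℝ) with hL
  -- the jet as a jointly continuous, doubly periodic function of (ϑ, θ)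
  set D : ℝ × ℝ → F := fun q => iteratedDeriv m (fun θ : ℝ => Ψ (θ, q.1 + θ)) q.2 with hD
  have hc : Continuous fun ϑ : ℝ => ((0 : ℝ), ϑ) := continuous_const.prodMk continuous_id
  have hDcont : Continuous D := by
    have hcont := continuous_iteratedFDeriv_comp_affine (C := ℝ) hΨ L hc m
    have heq : D = fun q : ℝ × ℝ =>
        (ContinuousMultilinearMap.piFieldEquiv ℝ (Fin m) F).symm
          (iteratedFDeriv ℝ m (fun θ : ℝ => Ψ (L θ + ((0 : ℝ), q.1))) q.2) := by
      funext q
      rw [hD]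
      simp only
      rw [coMoving_integrand_eq_affine Ψ q.1, iteratedDeriv_eq_equiv_comp]
      rfl
    rw [heq]
    exact (ContinuousMultilinearMap.piFieldEquiv ℝ (Fin m) F).symm.continuous.comp hcont
  -- periodicity in the loop angle
  have hDper1 : ∀ θ, Function.Periodic (fun ϑ => D (ϑ, θ)) T := by
    intro θ ϑ
    simp only [hD]
    congr 1
    funext θ'
    have := hper θ' (ϑ + θ')
    rw [show ϑ + T + θ' = ϑ + θ' + T by ring]
    exact this
  -- periodicity in the external angle (the co-moving integrand is `T`-periodic in `θ` because `Ψ` is, in both variables)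
  have hDper2 : ∀ ϑ, Function.Periodic (fun θ => D (ϑ, θ)) T := by
    intro ϑ θ
    simp only [hD]
    have hF : (fun z : ℝ => (fun θ' : ℝ => Ψ (θ', ϑ + θ')) (z + T)) = fun θ' : ℝ => Ψ (θ', ϑ + θ') := by
      funext z
      have h1 := hper (z + T) (ϑ + z)
      have h2 := hperθ (ϑ + z) z
      show Ψ (z + T, ϑ + (z + T)) = Ψ (z, ϑ + z)
      rw [show ϑ + (z + T) = ϑ + z + T by ring]
      exact h1.trans h2
    have key := congrFun (iteratedDeriv_comp_add_const m (fun θ' : ℝ => Ψ (θ', ϑ + θ')) T) θ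
    rw [hF] at key
    exact key.symm
  -- bounded on the compact fundamental domain, hence everywhere
  obtain ⟨C, hC⟩ : ∃ C, ∀ y ∈ D '' ((Icc 0 T) ×ˢ (Icc 0 T)), ‖y‖ ≤ C :=
    ((isCompact_Icc.prod isCompact_Icc).image_of_continuousOn hDcont.continuousOn).isBounded.exists_norm_le
  have hbound : ∀ ϑ θ, ‖D (ϑ, θ)‖ ≤ C := by
    intro ϑ θ
    obtain ⟨ϑ₀, hϑ₀, h1⟩ := (hDper1 θ).exists_mem_Ico₀ hT ϑ
    obtain ⟨θ₀, hθ₀, h2⟩ := (hDper2 ϑ₀).exists_mem_Ico₀ hT θ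
    have h1' : D (ϑ, θ) = D (ϑ₀, θ) := h1
    have h2' : D (ϑ₀, θ) = D (ϑ₀, θ₀) := h2
    rw [h1', h2']
    exact hC _ (mem_image_of_mem D (mk_mem_prod (Ico_subset_Icc_self hϑ₀) (Ico_subset_Icc_self hθ₀)))
  refine ⟨fun _ => C, ?_, fun ϑ θ => hbound ϑ θ⟩
  exact ((continuous_const (y := C)).integrableOn_Icc (a := (0 : ℝ)) (b := T)).mono_set Ioc_subset_Icc_self

end Jets

/-! ## §3 Read through the co-moving vocabulary -/

section CoMoving

variable [CompleteSpace F]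

/-- **Jets of a co-moving loop integral.**  For an angular weight `w` (the Jacobian of the chart times the slice profile at fixed
level) and a kernel `V`, put `Ψ(θ, ϑ) := w ϑ • V(Φ(0, θ), Φ(ρ, ϑ))`, `Φ = levelPoint μ K`.  If `Ψ` is jointly `C^∞`, `T`-periodic in `ϑ`,
with co-moving jets dominated at every order, then
`‖∂_θⁿ ∫_{0}^{T} w(ϑ) • V(Φ(0,θ), Φ(ρ,ϑ)) dϑ‖ ≤ ∫_{0}^{T} g`, where `g(ϑ)` bounds the `n`-th jet of
`θ ↦ w(ϑ + θ) • coMoving μ K V 0 ρ ϑ θ` (the integrand read along the co-moving field). -/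
theorem norm_iteratedDeriv_coMoving_integral_le {w : ℝ → ℝ} {V : Momentum → Momentum → F} {μ ρ T : ℝ}
    {K : TrigPolyC4v} (hT : 0 < T)
    (hΨ : ContDiff ℝ ∞ fun p : ℝ × ℝ => w p.2 • V (levelPoint μ K 0 p.1) (levelPoint μ K ρ p.2))
    (hper : ∀ θ, Function.Periodic (fun ϑ => w ϑ • V (levelPoint μ K 0 θ) (levelPoint μ K ρ ϑ)) T)
    (hdom : ∀ m : ℕ, ∃ g : ℝ → ℝ, IntegrableOn g (Ioc 0 T) ∧
      ∀ ϑ θ, ‖iteratedDeriv m (fun θ : ℝ => w (ϑ + θ) • V (levelPoint μ K 0 θ) (levelPoint μ K ρ (ϑ + θ))) θ‖ ≤ g ϑ)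
    {n : ℕ} {θ : ℝ} {g : ℝ → ℝ} (hg : IntegrableOn g (Ioc 0 T))
    (hb : ∀ ϑ, ‖iteratedDeriv n (fun θ : ℝ => w (ϑ + θ) • V (levelPoint μ K 0 θ) (levelPoint μ K ρ (ϑ + θ))) θ‖ ≤ g ϑ) :
    ‖iteratedDeriv n (fun θ : ℝ => ∫ ϑ in (0 : ℝ)..T, w ϑ • V (levelPoint μ K 0 θ) (levelPoint μ K ρ ϑ)) θ‖ ≤
      ∫ ϑ in (0 : ℝ)..T, g ϑ :=
  norm_iteratedDeriv_periodic_integral_le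
    (Ψ := fun p : ℝ × ℝ => w p.2 • V (levelPoint μ K 0 p.1) (levelPoint μ K ρ p.2)) hΨ hT hper hdom hg hb

/-- The co-moving integrand IS `w(ϑ + θ) • coMoving μ K V 0 ρ ϑ θ` (base angle `0`, time `θ`). -/
theorem coMoving_integrand_eq (w : ℝ → ℝ) (V : Momentum → Momentum → ℂ) (μ ρ : ℝ) (K : TrigPolyC4v) (ϑ θ : ℝ) :
    w (ϑ + θ) • V (levelPoint μ K 0 θ) (levelPoint μ K ρ (ϑ + θ)) = w (ϑ + θ) • coMoving μ K V 0 ρ ϑ θ := by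
  simp [coMoving]

end CoMoving


/-! ## §4 The TUBE form (appended): loop variable `(ρ, ϑ)` on `(−r, r) × (0, T]`, shift in the angle only -/

section Tube

variable [CompleteSpace F]

omit [NormedSpace ℝ F] [CompleteSpace F] in
/-- Continuity ⇒ integrability on the bounded tube `Ioo (−r) r ×ˢ Ioc 0 T` (via the compact closure `Icc × Icc`). -/
theorem integrableOn_tube_of_continuous {f : ℝ × ℝ → F} (hf : Continuous f) (r T : ℝ) :
    IntegrableOn f (Ioo (-r) r ×ˢ Ioc 0 T) := by
  have hK : IsCompact (Icc (-r) r ×ˢ Icc 0 T) := isCompact_Icc.prod isCompact_Icc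
  exact (hf.continuousOn.integrableOn_compact hK).mono_set (prod_mono Ioo_subset_Icc_self Ioc_subset_Icc_self)

omit [CompleteSpace F] in
/-- **Angular shift on the tube**: for `Ψ(θ, (ρ, ϑ))` continuous and `T`-periodic in `ϑ`,
`∫_{(ρ,ϑ) ∈ (−r,r)×(0,T]} Ψ(θ,(ρ,ϑ)) = ∫_{(ρ,ϑ)} Ψ(θ,(ρ, ϑ + θ))` (Fubini + the periodic shift in `ϑ` at each `ρ`). -/
theorem setIntegral_tube_eq_coMoving {Ψ : ℝ × (ℝ × ℝ) → F} (hΨ : Continuous Ψ) {r T : ℝ} (hT : 0 < T)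
    (hper : ∀ θ ρ, Function.Periodic (fun ϑ => Ψ (θ, (ρ, ϑ))) T) (θ : ℝ) :
    ∫ a in Ioo (-r) r ×ˢ Ioc 0 T, Ψ (θ, a) = ∫ a in Ioo (-r) r ×ˢ Ioc 0 T, Ψ (θ, (a.1, a.2 + θ)) := by
  have hc1 : Continuous fun a : ℝ × ℝ => Ψ (θ, a) := hΨ.comp (continuous_const.prodMk continuous_id)
  have hc2 : Continuous fun a : ℝ × ℝ => Ψ (θ, (a.1, a.2 + θ)) :=
    hΨ.comp (continuous_const.prodMk (continuous_fst.prodMk (continuous_snd.add continuous_const)))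
  have h1 := integrableOn_tube_of_continuous hc1 r T
  have h2 := integrableOn_tube_of_continuous hc2 r T
  rw [Measure.volume_eq_prod] at h1 h2 ⊢
  rw [setIntegral_prod _ h1, setIntegral_prod _ h2]
  refine setIntegral_congr_fun measurableSet_Ioo fun ρ _ => ?_
  simp only
  rw [← intervalIntegral.integral_of_le hT.le, ← intervalIntegral.integral_of_le hT.le]
  exact (intervalIntegral_periodic_shift (hper θ ρ) θ).symm

omit [NormedAddCommGroup F] [NormedSpace ℝ F] [CompleteSpace F] in
/-- The co-moving tube integrand `θ ↦ Ψ(θ, (ρ, ϑ + θ))` is `Ψ` along the affine map `θ ↦ (θ, (0, θ)) + (0, (ρ, ϑ))`. -/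
theorem coMoving_tube_integrand_eq_affine (Ψ : ℝ × (ℝ × ℝ) → F) (a : ℝ × ℝ) :
    (fun θ : ℝ => Ψ (θ, (a.1, a.2 + θ))) =
      fun θ : ℝ => Ψ (((ContinuousLinearMap.id ℝ ℝ).prod
        ((0 : ℝ →L[ℝ] ℝ).prod (ContinuousLinearMap.id ℝ ℝ))) θ + ((0 : ℝ), (a.1, a.2))) := by
  funext θ
  congr 1
  ext <;> simp [add_comm]

/-- **Jets of the tube integral ≤ integrated co-moving jets** (the (L2) shape: loop variable `(ρ, ϑ)` = (level, angle) of the slice momentum in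
the chart, external angle `θ`; the angle is shifted along, the level is not).  `Ψ` jointly `C^∞`, `T`-periodic in `ϑ`, co-moving jets dominated at
every order on the tube; then `‖∂_θⁿ ∫_{tube} Ψ(θ, a) da‖ ≤ ∫_{tube} g` whenever `‖∂_θⁿ Ψ(θ, (ρ, ϑ + θ))‖ ≤ g(ρ, ϑ)`. -/
theorem norm_iteratedDeriv_tube_integral_le {Ψ : ℝ × (ℝ × ℝ) → F} (hΨ : ContDiff ℝ ∞ Ψ) {r T : ℝ} (hT : 0 < T)
    (hper : ∀ θ ρ, Function.Periodic (fun ϑ => Ψ (θ, (ρ, ϑ))) T)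
    (hdom : ∀ m : ℕ, ∃ g : ℝ × ℝ → ℝ, IntegrableOn g (Ioo (-r) r ×ˢ Ioc 0 T) ∧
      ∀ a θ, ‖iteratedDeriv m (fun θ : ℝ => Ψ (θ, (a.1, a.2 + θ))) θ‖ ≤ g a)
    {n : ℕ} {θ : ℝ} {g : ℝ × ℝ → ℝ} (hg : IntegrableOn g (Ioo (-r) r ×ˢ Ioc 0 T))
    (hb : ∀ a, ‖iteratedDeriv n (fun θ : ℝ => Ψ (θ, (a.1, a.2 + θ))) θ‖ ≤ g a) :
    ‖iteratedDeriv n (fun θ : ℝ => ∫ a in Ioo (-r) r ×ˢ Ioc 0 T, Ψ (θ, a)) θ‖ ≤ ∫ a in Ioo (-r) r ×ˢ Ioc 0 T, g a := by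
  set A : Set (ℝ × ℝ) := Ioo (-r) r ×ˢ Ioc 0 T with hA
  set μ : Measure (ℝ × ℝ) := volume.restrict A with hμ
  set H : ℝ × ℝ → ℝ → F := fun a θ => Ψ (θ, (a.1, a.2 + θ)) with hH
  have hfun : (fun θ : ℝ => ∫ a in A, Ψ (θ, a)) = fun θ => ∫ a, H a θ ∂μ := by
    funext θ'
    exact setIntegral_tube_eq_coMoving hΨ.continuous hT hper θ'
  set L : ℝ →L[ℝ] ℝ × (ℝ × ℝ) := (ContinuousLinearMap.id ℝ ℝ).prod ((0 : ℝ →L[ℝ] ℝ).prod (ContinuousLinearMap.id ℝ ℝ)) with hL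
  have hHaff : ∀ a, H a = fun θ : ℝ => Ψ (L θ + ((0 : ℝ), (a.1, a.2))) := fun a => coMoving_tube_integrand_eq_affine Ψ a
  have h1 : ∀ a, ContDiff ℝ ∞ (H a) := by
    intro a; rw [hHaff a]; exact hΨ.comp ((L.contDiff).add contDiff_const)
  have h2 : ∀ (m : ℕ) (p : ℝ), AEStronglyMeasurable (fun a => iteratedFDeriv ℝ m (H a) p) μ := by
    intro m p
    have hc : Continuous fun a : ℝ × ℝ => ((0 : ℝ), (a.1, a.2)) := continuous_const.prodMk (continuous_fst.prodMk continuous_snd)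
    have hcont := continuous_iteratedFDeriv_comp_affine_param (C := ℝ × ℝ) hΨ L hc m p
    have heq : (fun a => iteratedFDeriv ℝ m (H a) p) =
        fun a : ℝ × ℝ => iteratedFDeriv ℝ m (fun θ : ℝ => Ψ (L θ + ((0 : ℝ), (a.1, a.2)))) p := by
      funext a; rw [hHaff a]
    rw [heq]
    exact hcont.aestronglyMeasurable
  have h3 : ∀ m : ℕ, ∃ g : ℝ × ℝ → ℝ, Integrable g μ ∧ ∀ a p, ‖iteratedFDeriv ℝ m (H a) p‖ ≤ g a := by
    intro m
    obtain ⟨g', hg', hb'⟩ := hdom m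
    exact ⟨g', hg', fun a p => by rw [norm_iteratedFDeriv_eq_norm_iteratedDeriv]; exact hb' a p⟩
  have hb2 : ∀ a, ‖iteratedFDeriv ℝ n (H a) θ‖ ≤ g a := fun a => by
    rw [norm_iteratedFDeriv_eq_norm_iteratedDeriv]; exact hb a
  have hmain := norm_iteratedFDeriv_integral_le (μ := μ) h1 h2 h3 (n := n) (p := θ) hg hb2
  rw [hfun, ← norm_iteratedFDeriv_eq_norm_iteratedDeriv]
  exact hmain

end Tube

end Summit.HubbardSuperconductivity.HubbardSuperconductivity.Theorems.C4a
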